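import Literature.MathematicalPhysics.QuantumFieldTheory.Balaban1983to89.B8Ineq1144ClassAk
import Literature.MathematicalPhysics.QuantumFieldTheory.Balaban1983to89.B8Eq119TwistedAxial

/-!
# `Balaban1983to89.B8Ineq1144TwistedAxial` — [Balaban1985RegularSpaces] Proposition 7 p. 100, display (1.144)
# «U′U₀ = (U₁U₀)^u ∈ 𝔄_k({Ω_j}, α₀ + 3α₂) ∩ Ax_k(𝔅_k, U₀)» — BOTH clauses for the tree's relative axial
# representative `u = B8Eq119TwistedAxial.twGauge` on the `ℤ^d` carriers

statement-level skeleton of published theorems with citation tags; proofs where landed; nothing here is a claim about the Yang–Mills mass gap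

T. Bałaban, *Spaces of regular gauge field configurations on a lattice and gauge fixing conditions*, Commun.
Math. Phys. **99** (1985) 75–102 `[Balaban1985RegularSpaces]` ("B8"; printed page = PDF page + 74).
PDF held: `paper:balaban1985-cmp99-regular-spaces-gauge-fixing` (lit store), p. 100 read as text (`p0026.txt`).
STATUS: published, refereed; this file JOINS two kernel results of the tree — the `𝔄_k`-clause of (1.144)
(`B8Ineq1144ClassAk.inAk_mulCfg_gaugeAct`, valid for EVERY gauge transformation) and the relative axial gauge
fixing (1.19) (`B8Eq119TwistedAxial.twistedFix_global` / `inAx_twistedFix`) — nothing here is new mathematics or a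
claim about the Clay problem.

WHAT IS REPRODUCED (lit-balaban SKELETON row): **B8.Prop7**, display (1.144) with BOTH memberships, for the gauge
transformation `u = twGauge L U₀ (U₁U₀) k y` of the tree (an element of the (1.14)-orbit of `U₁U₀` satisfying (1.19);
print normalises `u` by (1.29), the tree by `u(Lᵏy) = 1` — see HONEST SCOPE (ii)).  Unit `lit-balaban-p40` (Phase-2
proof seat p40, gen 4), HOME `run/shared/lean/pub/lit-balaban/` (SKELETON.md row B8.Prop7; owner fold
`lit-balaban-r05/ROWS-B8.md`).

## THE PRINTED TEXT (p. 100 [PDF 26])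

«Let us take a gauge transformation u satisfying the conditions (1.29) and such that the configuration
U′ = (U₁U₀)^u U₀⁻¹ satisfies the axial gauge conditions (1.19). This gauge transformation is determined uniquely.
The above bounds imply the following
Proposition 7. If the configurations U₀, A satisfy (1.139), (1.140), then for α₀, α₂ sufficiently small we have
U′U₀ = (U₁U₀)^u ∈ 𝔄_k({Ω_j}, α₀ + 3α₂) ∩ Ax_k(𝔅_k, U₀), (1.144) …»
(p. 79: «The conditions (1.19) determine uniquely an element in each orbit given by the subgroup (1.14). We denote
this gauge condition by Ax_k(𝔅_k, U₀).»)

## WHAT IS CERTIFIED HERE (kernel; axioms `propext` / `Classical.choice` / `Quot.sound`)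

Carriers and dictionary as in `B8Ineq1141SectG` / `B8Ineq1144ClassAk` (`ℤ^d` sites, bond fields
`Site d → Fin d → 𝔸ˣ`, `U₁U₀ = mulCfg`, `U₁ = e^{iηA} = expCfg (iEta η A)`, (1.139)/(1.140) at the top level `k`
on the whole lattice); `𝔄_k = B8Ineq132.InAk`, `Ax_k(ℭ, U₀) = B8Eq119TwistedAxial.InAx`, the plaquette deviation
`sup_p |U(∂p) − 1| = B7Prop2Explicit.pdev`, the gauge group an averaging-closed `G ≤ U1` (`B7Prop2Explicit.AvgClosed`;
the unitary group of a C⋆-algebra qualifies):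
* §1 `pdev_le_of_forall`, `pdev_mulCfg_le` — «|(U₁U₀)(∂p) − 1| < (α₀ + 3α₂)L^{−2j}» (`B8Ineq1144ClassAk.ineq1141_lt`)
  summed up as `sup_p |(U₁U₀)(∂p) − 1| ≤ (α₀ + 3α₂)L^{−2k}` — the (1.7)-type input of the axial gauge fixing.
* §2 **`prop7_1144_twGauge`** — for `G`-valued `U₀` and `U₁ = e^{iηA}` (`|U₁ − 1| ≤ α₂(Lᵏη)⁻¹η`), (1.139) as
  `U₀ ∈ 𝔄_k({T_η, …, T_η}, α₀)`, the three members of (1.140) at level `k` on all bonds, `0 < α₀`, `0 ≤ α₂`,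
  `α₀, α₂ ≤ 1/(80d)` and the Prop.-2-of-[3] smallness of `(α₀ + 3α₂)L²` (`C₀(d)(α₀ + 3α₂)L² ≤ 1/3`,
  `2(α₀ + 3α₂)L² ≤ c₂′(d, L)`): with `u := twGauge L U₀ (U₁U₀) k y` — `u` is `G`-valued,
  `(U₁U₀)^u ∈ 𝔄_k({Ω_j}, α₀ + 3α₂)` for every family `{Ω_j}` AND `(U₁U₀)^u ∈ Ax_k(ℭ, U₀)` for every `ℭ`.
* §3 the Hermitian/unitary case (`𝔸` a C⋆-algebra, `G` = its unitary group, `A(b)` self-adjoint): `prop7_1144_unitary`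
  (the two `U₁`-hypotheses discharged) and **`prop7_1144`** — the sentence shape «for α₀, α₂ sufficiently small»
  = `∃ c > 0` (`c = min(1/(80d), 1/(12L²C₀(d)), c₂′(d,L)/(8L²))`, depending on `d` and `L` only), `∀ α₀, α₂ ∈ (0, c]`:
  (1.139) ∧ (1.140) ⟹ both memberships of (1.144) for `u = twGauge L U₀ (U₁U₀) k y`, every `y`, `{Ω_j}`, `ℭ`.

## HONEST SCOPE — what is NOT claimed

(i) GLOBAL READING of (1.139)/(1.140) at the top level `k` (print's admitted case «Ω_j = T_η», p. 77), as in the two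
companions; localisation to a general admissible family not reproduced.
(ii) THE GAUGE TRANSFORMATION.  Print's `u` is the (1.19)-representative normalised by the restrictions (1.29)
(«determined uniquely»); the tree's `twGauge L U₀ U k y` is the (1.19)-representative normalised by `u(Lᵏy) = 1`
(`B8Eq119TwistedAxial.twGauge_top`; uniqueness up to the residual freedom `twistedFix_unique`).  Both lie in the
(1.14)-orbit through (1.19); the (1.29)-normalised representative is NOT constructed here (it is Theorem 4 / row
B8.Eq1.19 material), so (1.144) is certified for the tree's representative, and its `𝔄_k`-clause for every `u`
(`B8Ineq1144ClassAk.inAk_mulCfg_gaugeAct`).  (1.145) is not touched (owner's `B8Ineq145*` lane).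
(iii) «α₀, α₂ sufficiently small» ↦ explicit: `α₀, α₂ ≤ 1/(80d)` (the `𝔄_k`-clause) and the Prop.-2-of-[3] window
for the axial gauge fixing of BOTH `U₀` and `U₁U₀` at deviation `(α₀ + 3α₂)L²·L^{−2k}` (`B8Eq119TwistedAxial.twistedFix_global`
asks `sup_p|U(∂p) − 1| < α·L²·L^{−2k}`; the factor `L² > 1` turns the non-strict supremum bound into the strict one).
-/

noncomputable section

open scoped BigOperators
open NormedSpace

namespace Literature.MathematicalPhysics.QuantumFieldTheory.Balaban1983to89.B8Ineq1144TwistedAxial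

open B7Prop1Explicit
open B7Prop1Local (hol_plaqWord_eq)
open B7Prop2Explicit (pdev C0 c2' C0_pos c2'_pos AvgClosed unitaryUnits unitaryUnits_le_U1 avgClosed_unitaryUnits)
open B8Lemma1NonAbelian (mulCfg)
open B8Ineq132 (plaqF covDerivFwd covDiv InAk)
open B8Eq143PlaqExpansion (pdiv)
open B8Eq146AExpansion (expCfg iEta plaqCovDeriv)
open B8Eq155JBound (expCfg_iEta_mem_unitaryUnits norm_expCfg_iEta_sub_one_le_of_141)
open B8Eq119TwistedAxial (InAx twGauge twistedFix_global inAx_twistedFix)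
open B8Ineq1144ClassAk (ineq1141_lt inAk_mulCfg_gaugeAct forall_of_inAk_univ)

-- `Site` alone would resolve to the torus sites of `Setup.lean`; re-export the `ℤ^d` sites of `B7Prop1Explicit`.
export B7Prop1Explicit (Site)

variable {d : ℕ}

/-! ## §1. The plaquette deviation of `U₁U₀` -/

section Dev

variable {𝔸 : Type*} [NormedRing 𝔸] [NormOneClass 𝔸] [NormedAlgebra ℂ 𝔸] [CompleteSpace 𝔸]

omit [NormOneClass 𝔸] [NormedAlgebra ℂ 𝔸] [CompleteSpace 𝔸] in
/-- A degenerate `p_{κκ}(x)` has trivial holonomy. [folklore] -/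
private theorem plaqF_self (V : Site d → Fin d → 𝔸ˣ) (κ : Fin d) (x : Site d) : plaqF V κ κ x = 1 := by
  unfold plaqF
  rw [hol_plaqWord_eq, mul_inv_cancel_right, mul_inv_cancel, Units.val_one]

omit [NormOneClass 𝔸] [NormedAlgebra ℂ 𝔸] [CompleteSpace 𝔸] in
/-- `sup_p |V(∂p) − 1| ≤ b` from `|V(∂p) − 1| ≤ b` at every plaquette `p_{κν}(x)`, `κ ≠ ν` (`b ≥ 0`): the pointwise
form of the (1.7)-type hypothesis «|U(∂p) − 1| < α₀η²» of [3] (52) / B8 (1.139) as the supremum `B7Prop2Explicit.pdev`.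
[cite: Balaban1985RegularSpaces, (1.7) p.77, (1.139) p.100; Balaban1985Averaging, (52) p.26] -/
theorem pdev_le_of_forall {V : Site d → Fin d → 𝔸ˣ} {b : ℝ} (hb : 0 ≤ b)
    (h : ∀ (x : Site d) (κ ν : Fin d), κ ≠ ν → ‖plaqF V κ ν x - 1‖ ≤ b) : pdev V ≤ b := by
  unfold pdev
  refine Real.iSup_le (fun p => ?_) hb
  rcases eq_or_ne p.2.1 p.2.2 with hp | hp
  · have h1 : plaqF V p.2.1 p.2.2 p.1 = 1 := by rw [hp]; exact plaqF_self V p.2.2 p.1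
    have : ‖plaqF V p.2.1 p.2.2 p.1 - 1‖ ≤ b := by rw [h1, sub_self, norm_zero]; exact hb
    exact this
  · exact h p.1 p.2.1 p.2.2 hp

/-- **«|(U₁U₀)(∂p) − 1| < (α₀ + 3α₂)L^{−2j} on Ω_j» summed up as a supremum** at the top level `k` on the whole
lattice: under the hypotheses of `B8Ineq1144ClassAk.ineq1141_lt` at every plaquette,
`sup_p |(U₁U₀)(∂p) − 1| ≤ (α₀ + 3α₂)L^{−2k}`. [cite: Balaban1985RegularSpaces, (1.141) + (1.144) p.100] -/
theorem pdev_mulCfg_le {η : ℝ} (hη : 0 < η) {U₀ : Site d → Fin d → 𝔸ˣ} (h₀ : ∀ y κ, U₀ y κ ∈ U1 𝔸)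
    {A : Site d → Fin d → 𝔸} (h₁ : ∀ y κ, expCfg (iEta η A) y κ ∈ U1 𝔸) {L : ℕ} (hL : 1 ≤ L) {k : ℕ}
    {α₀ α₂ : ℝ} (hα₀ : 0 ≤ α₀) (hα₀c : α₀ ≤ 1 / 8) (hα₂ : 0 ≤ α₂) (hα₂c : α₂ ≤ 1 / 20)
    (hu : ∀ y κ, ‖(expCfg (iEta η A) y κ : 𝔸) - 1‖ ≤ α₂ * ((L : ℝ) ^ k * η)⁻¹ * η)
    (hA : ∀ y κ, ‖A y κ‖ ≤ α₂ * ((L : ℝ) ^ k * η)⁻¹)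
    (hG : ∀ (y : Site d) (κ τ : Fin d), ‖covDerivFwd η U₀ κ (fun z => A z τ) y‖ ≤ α₂ * (((L : ℝ) ^ k * η)⁻¹) ^ 2)
    (h7 : ∀ (y : Site d) (κ ν : Fin d), κ ≠ ν → ‖plaqF U₀ κ ν y - 1‖ < α₀ * (((L : ℝ) ^ k)⁻¹) ^ 2) :
    pdev (mulCfg (expCfg (iEta η A)) U₀) ≤ (α₀ + 3 * α₂) * (((L : ℝ) ^ k)⁻¹) ^ 2 :=
  pdev_le_of_forall (by positivity) fun x κ ν hκν =>
    (ineq1141_lt hη h₀ h₁ hL hα₀ hα₀c hα₂ hα₂c hu hA hG (h7 x κ ν hκν)).le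

end Dev

/-! ## §2. (1.144), both clauses, for `u = twGauge L U₀ (U₁U₀) k y`, gauge group `G` averaging-closed -/

section Both

variable {𝔸 : Type*} [NormedRing 𝔸] [NormOneClass 𝔸] [NormedAlgebra ℂ 𝔸] [CompleteSpace 𝔸]

/-- **Proposition 7, (1.144) — BOTH memberships for the tree's relative axial representative.**  Let `G ≤ U1` be
averaging-closed (`B7Prop2Explicit.AvgClosed`), `U₀` `G`-valued with `U₀ ∈ 𝔄_k({T_η, …, T_η}, α₀)` ((1.139), top
level on the whole lattice), `U₁ = e^{iηA}` `G`-valued with `|U₁ − 1| ≤ α₂(Lᵏη)⁻¹η`, `A` with the three members of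
(1.140) at level `k` on all bonds, `0 < α₀ ≤ 1/(80d)`, `0 ≤ α₂ ≤ 1/(80d)`, `L ≥ 2`, `η > 0`, and the Prop.-2 window
`C₀(d)(α₀ + 3α₂)L² ≤ 1/3`, `2(α₀ + 3α₂)L² ≤ c₂′(d, L)`.  Then for `u := twGauge L U₀ (U₁U₀) k y` (any base point
`y`): `u` is `G`-valued, `(U₁U₀)^u ∈ 𝔄_k({Ω_j}, α₀ + 3α₂)` for every family `{Ω_j}`, and `(U₁U₀)^u ∈ Ax_k(ℭ, U₀)`
for every `ℭ`. [cite: Balaban1985RegularSpaces, Prop. 7 (1.144) p.100] -/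
theorem prop7_1144_twGauge {η : ℝ} (hη : 0 < η) {L : ℕ} (hL : 2 ≤ L) {G : Subgroup 𝔸ˣ} (hG : AvgClosed d L G)
    (k : ℕ) {U₀ : Site d → Fin d → 𝔸ˣ} (hU₀ : ∀ y κ, U₀ y κ ∈ G) {A : Site d → Fin d → 𝔸}
    (h₁ : ∀ y κ, expCfg (iEta η A) y κ ∈ G) {α₀ α₂ : ℝ} (hα₀ : 0 < α₀) (hα₀c : α₀ ≤ 1 / (80 * d))
    (hα₂ : 0 ≤ α₂) (hα₂c : α₂ ≤ 1 / (80 * d))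
    (hα3 : C0 d * ((α₀ + 3 * α₂) * (L : ℝ) ^ 2) ≤ 1 / 3) (hα2 : 2 * ((α₀ + 3 * α₂) * (L : ℝ) ^ 2) ≤ c2' d L)
    (hu : ∀ y κ, ‖(expCfg (iEta η A) y κ : 𝔸) - 1‖ ≤ α₂ * ((L : ℝ) ^ k * η)⁻¹ * η)
    (h139 : InAk L k η α₀ (fun _ => Set.univ) U₀)
    (hA : ∀ y κ, ‖A y κ‖ ≤ α₂ * ((L : ℝ) ^ k * η)⁻¹)
    (hG' : ∀ (y : Site d) (κ τ : Fin d), ‖covDerivFwd η U₀ κ (fun z => A z τ) y‖ ≤ α₂ * (((L : ℝ) ^ k * η)⁻¹) ^ 2)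
    (hDDA : ∀ (y : Site d) (κ : Fin d), ‖pdiv η U₀ (plaqCovDeriv η U₀ A) κ y‖ ≤ α₂ * (((L : ℝ) ^ k * η)⁻¹) ^ 3)
    (y : Site d) (Ω Λ : ℕ → Set (Site d)) :
    (∀ x, twGauge L U₀ (mulCfg (expCfg (iEta η A)) U₀) k y x ∈ G) ∧
      InAk L k η (α₀ + 3 * α₂) Ω
          (gaugeAct (twGauge L U₀ (mulCfg (expCfg (iEta η A)) U₀) k y) (mulCfg (expCfg (iEta η A)) U₀)) ∧
        InAx L k Λ U₀
          (gaugeAct (twGauge L U₀ (mulCfg (expCfg (iEta η A)) U₀) k y) (mulCfg (expCfg (iEta η A)) U₀)) := by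
  set U₁ := expCfg (iEta η A)
  set U := mulCfg U₁ U₀
  have hL1 : 1 ≤ L := le_trans (by norm_num) hL
  have h₀' : ∀ y κ, U₀ y κ ∈ U1 𝔸 := fun y κ => hG.le_U1 (hU₀ y κ)
  have h₁' : ∀ y κ, U₁ y κ ∈ U1 𝔸 := fun y κ => hG.le_U1 (h₁ y κ)
  have hU : ∀ x κ, U x κ ∈ G := fun x κ => G.mul_mem (h₁ x κ) (hU₀ x κ)
  obtain ⟨h7, h9⟩ := forall_of_inAk_univ h139
  -- the deviation window of the axial gauge fixing, at `α′ = α₀ + 3α₂`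
  set t : ℝ := (((L : ℝ) ^ k)⁻¹) ^ 2
  have ht : 0 < t := by positivity
  have hα' : 0 < α₀ + 3 * α₂ := by positivity
  have hL2 : (1 : ℝ) < (L : ℝ) ^ 2 := by
    have : (2 : ℝ) ≤ L := by exact_mod_cast hL
    nlinarith
  have hstrict : (α₀ + 3 * α₂) * t < (α₀ + 3 * α₂) * (L : ℝ) ^ 2 * t := by
    have : (α₀ + 3 * α₂) * t * 1 < (α₀ + 3 * α₂) * t * (L : ℝ) ^ 2 :=
      mul_lt_mul_of_pos_left hL2 (mul_pos hα' ht)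
    linarith
  have h17₀ : pdev U₀ < (α₀ + 3 * α₂) * (L : ℝ) ^ 2 * t := by
    have h1 : pdev U₀ ≤ α₀ * t := pdev_le_of_forall (by positivity) fun x κ ν hκν => (h7 x κ ν hκν).le
    have h2 : α₀ * t ≤ (α₀ + 3 * α₂) * t := by gcongr; linarith
    exact (h1.trans h2).trans_lt hstrict
  -- `d ≥ 1`: for `d = 0` the threshold `1/(80d)` is `0`, contradicting `0 < α₀`
  have hd1 : (1 : ℝ) ≤ d := by
    rcases Nat.eq_zero_or_pos d with h | h
    · exfalso; subst h; simp at hα₀c; linarith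
    · exact_mod_cast h
  have hα₀c' : α₀ ≤ 1 / 8 := hα₀c.trans (one_div_le_one_div_of_le (by norm_num) (by linarith))
  have hα₂c' : α₂ ≤ 1 / 20 := hα₂c.trans (one_div_le_one_div_of_le (by norm_num) (by linarith))
  have h17 : pdev U < (α₀ + 3 * α₂) * (L : ℝ) ^ 2 * t :=
    (pdev_mulCfg_le hη h₀' h₁' hL1 hα₀.le hα₀c' hα₂ hα₂c' hu hA hG' h7).trans_lt hstrict
  have hfix := twistedFix_global L hL hG k U₀ U hU₀ hU hα' hα3 hα2 h17₀ h17 y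
  refine ⟨hfix.1, ?_, inAx_twistedFix L hL hG k U₀ U hU₀ hU hα' hα3 hα2 h17₀ h17 y Λ⟩
  exact inAk_mulCfg_gaugeAct hη hL1 k h₀' h₁' hα₀.le hα₀c hα₂ hα₂c hu h7 h9 hA hG' hDDA Ω
    (fun x => hG.le_U1 (hfix.1 x))

end Both

end Literature.MathematicalPhysics.QuantumFieldTheory.Balaban1983to89.B8Ineq1144TwistedAxial

/-! ## §3. The unitary case: `G` = the unitary group of a C⋆-algebra, `A` Hermitian -/

namespace Literature.MathematicalPhysics.QuantumFieldTheory.Balaban1983to89.B8Ineq1144TwistedAxial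

open B7Prop1Explicit
open B7Prop2Explicit (C0 c2' C0_pos c2'_pos unitaryUnits avgClosed_unitaryUnits)
open B8Lemma1NonAbelian (mulCfg)
open B8Ineq132 (plaqF covDerivFwd covDiv InAk)
open B8Eq143PlaqExpansion (pdiv)
open B8Eq146AExpansion (expCfg iEta plaqCovDeriv)
open B8Eq155JBound (expCfg_iEta_mem_unitaryUnits norm_expCfg_iEta_sub_one_le_of_141)
open B8Eq119TwistedAxial (InAx twGauge)

variable {d : ℕ} {𝔸 : Type*} [CStarAlgebra 𝔸] [Nontrivial 𝔸]

/-- **(1.144), both clauses, unitary `U₀`, Hermitian `A`** (`U₁ = e^{iηA}` unitary and `|U₁ − 1| ≤ η|A|`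
discharged): with `u := twGauge L U₀ (U₁U₀) k y`, `u` is unitary-valued, `(U₁U₀)^u ∈ 𝔄_k({Ω_j}, α₀ + 3α₂)` and
`(U₁U₀)^u ∈ Ax_k(ℭ, U₀)`, under (1.139)/(1.140) at level `k` on the whole lattice, `0 < α₀ ≤ 1/(80d)`,
`0 ≤ α₂ ≤ 1/(80d)`, `C₀(d)(α₀ + 3α₂)L² ≤ 1/3`, `2(α₀ + 3α₂)L² ≤ c₂′(d, L)`, `L ≥ 2`, `η > 0`.
[cite: Balaban1985RegularSpaces, Prop. 7 (1.144) p.100] -/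
theorem prop7_1144_unitary {η : ℝ} (hη : 0 < η) {L : ℕ} (hL : 2 ≤ L) (k : ℕ) {U₀ : Site d → Fin d → 𝔸ˣ}
    (hU₀ : ∀ y κ, U₀ y κ ∈ unitaryUnits 𝔸) {A : Site d → Fin d → 𝔸} (hAh : ∀ y κ, IsSelfAdjoint (A y κ))
    {α₀ α₂ : ℝ} (hα₀ : 0 < α₀) (hα₀c : α₀ ≤ 1 / (80 * d)) (hα₂ : 0 ≤ α₂) (hα₂c : α₂ ≤ 1 / (80 * d))
    (hα3 : C0 d * ((α₀ + 3 * α₂) * (L : ℝ) ^ 2) ≤ 1 / 3) (hα2 : 2 * ((α₀ + 3 * α₂) * (L : ℝ) ^ 2) ≤ c2' d L)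
    (h139 : InAk L k η α₀ (fun _ => Set.univ) U₀)
    (hA : ∀ y κ, ‖A y κ‖ ≤ α₂ * ((L : ℝ) ^ k * η)⁻¹)
    (hG' : ∀ (y : Site d) (κ τ : Fin d), ‖covDerivFwd η U₀ κ (fun z => A z τ) y‖ ≤ α₂ * (((L : ℝ) ^ k * η)⁻¹) ^ 2)
    (hDDA : ∀ (y : Site d) (κ : Fin d), ‖pdiv η U₀ (plaqCovDeriv η U₀ A) κ y‖ ≤ α₂ * (((L : ℝ) ^ k * η)⁻¹) ^ 3)
    (y : Site d) (Ω Λ : ℕ → Set (Site d)) :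
    (∀ x, twGauge L U₀ (mulCfg (expCfg (iEta η A)) U₀) k y x ∈ unitaryUnits 𝔸) ∧
      InAk L k η (α₀ + 3 * α₂) Ω
          (gaugeAct (twGauge L U₀ (mulCfg (expCfg (iEta η A)) U₀) k y) (mulCfg (expCfg (iEta η A)) U₀)) ∧
        InAx L k Λ U₀
          (gaugeAct (twGauge L U₀ (mulCfg (expCfg (iEta η A)) U₀) k y) (mulCfg (expCfg (iEta η A)) U₀)) :=
  prop7_1144_twGauge hη hL (avgClosed_unitaryUnits d L) k hU₀ (expCfg_iEta_mem_unitaryUnits η hAh) hα₀ hα₀c hα₂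
    hα₂c hα3 hα2 (norm_expCfg_iEta_sub_one_le_of_141 hη.le hAh hA) h139 hA hG' hDDA y Ω Λ

/-- **Proposition 7, (1.144) in its printed sentence shape** («for α₀, α₂ sufficiently small» = `∃ c > 0`,
`c = min(1/(80d), 1/(12L²C₀(d)), c₂′(d, L)/(8L²))`, depending on `d ≥ 1` and `L ≥ 2` only): for unitary-valued `U₀`
and Hermitian `A` on the `ℤ^d` lattice with spacing `η > 0`, if `U₀ ∈ 𝔄_k({T_η, …, T_η}, α₀)` (1.139) and `A`
satisfies the three members of (1.140) at level `k`, `0 < α₀, α₂ ≤ c`, then for `U₁ = e^{iηA}` and the relative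
axial representative `u = twGauge L U₀ (U₁U₀) k y`: `(U₁U₀)^u ∈ 𝔄_k({Ω_j}, α₀ + 3α₂) ∩ Ax_k(ℭ, U₀)` for every
`{Ω_j}`, `ℭ`, `y` (and `u` is unitary-valued). [cite: Balaban1985RegularSpaces, Prop. 7 (1.144) p.100] -/
theorem prop7_1144 (hd : 1 ≤ d) {η : ℝ} (hη : 0 < η) {L : ℕ} (hL : 2 ≤ L) (k : ℕ) :
    ∃ c : ℝ, 0 < c ∧ ∀ α₀ α₂ : ℝ, 0 < α₀ → α₀ ≤ c → 0 < α₂ → α₂ ≤ c →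
      ∀ U₀ : Site d → Fin d → 𝔸ˣ, (∀ y κ, U₀ y κ ∈ unitaryUnits 𝔸) →
        ∀ A : Site d → Fin d → 𝔸, (∀ y κ, IsSelfAdjoint (A y κ)) →
          InAk L k η α₀ (fun _ => Set.univ) U₀ →
          (∀ y κ, ‖A y κ‖ ≤ α₂ * ((L : ℝ) ^ k * η)⁻¹) →
          (∀ (y : Site d) (κ τ : Fin d),
              ‖covDerivFwd η U₀ κ (fun z => A z τ) y‖ ≤ α₂ * (((L : ℝ) ^ k * η)⁻¹) ^ 2) →
          (∀ (y : Site d) (κ : Fin d),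
              ‖pdiv η U₀ (plaqCovDeriv η U₀ A) κ y‖ ≤ α₂ * (((L : ℝ) ^ k * η)⁻¹) ^ 3) →
            ∀ (y : Site d) (Ω Λ : ℕ → Set (Site d)),
              (∀ x, twGauge L U₀ (mulCfg (expCfg (iEta η A)) U₀) k y x ∈ unitaryUnits 𝔸) ∧
                InAk L k η (α₀ + 3 * α₂) Ω
                    (gaugeAct (twGauge L U₀ (mulCfg (expCfg (iEta η A)) U₀) k y)
                      (mulCfg (expCfg (iEta η A)) U₀)) ∧
                  InAx L k Λ U₀
                    (gaugeAct (twGauge L U₀ (mulCfg (expCfg (iEta η A)) U₀) k y)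
                      (mulCfg (expCfg (iEta η A)) U₀)) := by
  have hL1 : 1 ≤ L := le_trans (by norm_num) hL
  have hLr : (2 : ℝ) ≤ L := by exact_mod_cast hL
  have hL2 : (0 : ℝ) < (L : ℝ) ^ 2 := by positivity
  have hC0 := C0_pos d
  have hc2 := c2'_pos d L hL1
  have hd' : (0 : ℝ) < 80 * d := by
    have : (1 : ℝ) ≤ d := by exact_mod_cast hd
    positivity
  set c : ℝ := min (1 / (80 * d)) (min (1 / (12 * (L : ℝ) ^ 2 * C0 d)) (c2' d L / (8 * (L : ℝ) ^ 2))) with hc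
  have hc80 : c ≤ 1 / (80 * d) := min_le_left _ _
  have hcC0 : c ≤ 1 / (12 * (L : ℝ) ^ 2 * C0 d) := (min_le_right _ _).trans (min_le_left _ _)
  have hcc2 : c ≤ c2' d L / (8 * (L : ℝ) ^ 2) := (min_le_right _ _).trans (min_le_right _ _)
  refine ⟨c, by positivity, ?_⟩
  intro α₀ α₂ hα₀ hα₀c hα₂ hα₂c U₀ hU₀ A hAh h139 hA hG' hDDA y Ω Λ
  have hsum : α₀ + 3 * α₂ ≤ 4 * c := by linarith
  have hα3 : C0 d * ((α₀ + 3 * α₂) * (L : ℝ) ^ 2) ≤ 1 / 3 := by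
    have h1 : C0 d * ((α₀ + 3 * α₂) * (L : ℝ) ^ 2) ≤ C0 d * ((4 * c) * (L : ℝ) ^ 2) := by gcongr
    have h2 : c * (12 * (L : ℝ) ^ 2 * C0 d) ≤ 1 := by
      rwa [le_div_iff₀ (by positivity)] at hcC0
    nlinarith
  have hα2 : 2 * ((α₀ + 3 * α₂) * (L : ℝ) ^ 2) ≤ c2' d L := by
    have h1 : 2 * ((α₀ + 3 * α₂) * (L : ℝ) ^ 2) ≤ 2 * ((4 * c) * (L : ℝ) ^ 2) := by gcongr
    have h2 : c * (8 * (L : ℝ) ^ 2) ≤ c2' d L := by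
      rwa [le_div_iff₀ (by positivity)] at hcc2
    nlinarith
  exact prop7_1144_unitary hη hL k hU₀ hAh hα₀ (hα₀c.trans hc80) hα₂.le (hα₂c.trans hc80) hα3 hα2 h139 hA hG'
    hDDA y Ω Λ

#print axioms prop7_1144_twGauge
#print axioms prop7_1144

end Literature.MathematicalPhysics.QuantumFieldTheory.Balaban1983to89.B8Ineq1144TwistedAxial

end
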